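import Summits.BirchSwinnertonDyer.BirchSwinnertonDyer.Theorems.PrintCFramBottomClassIndexLawFiveLeBorelNoPTorsionInputs
import Summits.BirchSwinnertonDyer.BirchSwinnertonDyer.Theorems.PrintCFramBottomClassIndexLawFiveLeHerbrandLineRestriction
import Literature.NumberTheory.EllipticCurves.HeegnerPointsKolyvaginCebotarevProofs
import Literature.NumberTheory.EllipticCurves.HeegnerPointsKolyvaginConjugation
import Literature.NumberTheory.GaloisRepresentations.AbsIntegersEquiv
import HarnessLib

/-!
# Crux `PrintCFram.BottomClassIndexLawFiveLe` (stmt-BirchSwinnertonDyer-20372), line `eisenstein-resource-bdp-line` (v10):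
# Stub H — the input AT THE PRIMES ABOVE `p`: inertia at every `𝔓 ∣ p` of `\bar ℤ_{K''}` acts on `W_{K''}[p]` through a
# NON-TRIVIAL HOMOTHETY, so `θ|_{I_𝔓} ≠ 1 ≠ θ'|_{I_𝔓}` for both characters of every stable line

Cell `bsd-print-cfram`, width seat `bsd-line-cfram-p1-w4` (generation g5), `--supports stmt-BirchSwinnertonDyer-20372` (helper).
THEOREMS ONLY; no definition, no named fact, no `sorry`. BSD is not proved by any of this; no summit statement is proved by this
seat; no stub is closed.

WHY. Step M1 §4 of Stub H's anatomy (`Lines/herbrand-regular-locus-M1-anatomy.md`) kills the local terms of the class-field-theory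
sequence by «`θ|_{Δ_𝔭} ≠ 1`» ((i): `(Ind_{Δ_𝔭}^Δ 𝟙)^{(θ)} = 0`, w4 g4's `iInf_eigenspace_coind_trivial_eq_bot_iff`) and «`θ|_{I_𝔭̄} ≠ ω|_{I_𝔭̄}`»,
i.e. `θ'|_{I_𝔭̄} ≠ 1` ((iii): only principal units survive); the Kummer-duality route (w8's 16:31Z architecture note) needs the same
«non-trivial on `D_p`». All of these follow from ONE class-side fact, proved here in the `primesAbove`/`Ideal.inertia` currency of the
T2′ socket (`…HerbrandSelmerToHomPrimes`, p651053): **for every prime `𝔓` of `\bar ℤ_K` above a place `w ∋ p` of the Heegner field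
`K`, some `g ∈ I_𝔓 ≤ Γ_K` acts on `W_K[p]` as a scalar `c ≢ 1 (mod p)`** — w4 g2's inertia homothety over `ℚ`
(`BorelTorsion.exists_sq_mem_inertia_homothety`, at the contraction `𝔓 ∩ \bar ℤ_ℚ`) pulled back along `res : Γ_K → Γ_ℚ`, which is
possible because `p ∣ N_W` splits in `K` (`BorelTorsion.isUnramifiedIn_heegnerField_of_cmRamified`, tree
`inertia_le_range_absGaloisRestrict_of_isUnramifiedIn`, `comap_inertia_comap_absIntegersMap`, `RatClosure.torsionEquiv_smul`).

* §1 `smul_ne_sub_of_homothety` / `smul_ne_quot_of_homothety` (generic: an element acting on `E[p]` as `c ≢ 1` moves every non-zero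
  vector of `Φ` and of `E[p]/Φ`), `apply_ne_one_of_smul_ne` (then `θ(g) ≠ 1` for any character `θ` of the module, T2 currency).
* §2 **`exists_mem_inertia_homothety_of_isUnramifiedIn`** — `W` CM, `p ≥ 5` CM-ramified, `K` Galois over `ℚ` unramified above `p`,
  `w ∋ p`, `𝔓 ∈ w.primesAbove`: `∃ g ∈ 𝔓.inertia Γ_K, ∃ c, ¬ p ∣ c − 1 ∧ ∀ Q ∈ W_K[p], g • Q = c • Q`;
  **`exists_mem_inertia_homothety_heegnerField`** — the same at the Heegner field of Stub H (`IsImaginaryQuadratic K`,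
  `SatisfiesHeegnerHypothesis (N_W) K`).
* §3 ON THE CLASS with Stub H's quantifiers: **`exists_mem_inertia_smul_ne_sub_and_quot`** (for every stable `Φ` of order `p` and
  every `𝔓 ∣ p`: one `g ∈ I_𝔓` moving a vector of `Φ` AND of `W_K[p]/Φ`), **`exists_mem_inertia_charSub_ne_one`** /
  **`exists_mem_inertia_charQuot_ne_one`** (`θ|_{I_𝔓} ≠ 1`, `θ'|_{I_𝔓} ≠ 1` for the T2 characters).

References: Neukirch, *Algebraic Number Theory* I §9 (9.4)–(9.6); Gross, LMS 153 (1991) §9; Serre, *Local Fields* IV §4; the herbrand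
M1 memo §4 (crux workfile).
-/

noncomputable section

-- summit-side namespace `Summit.BirchSwinnertonDyer.BirchSwinnertonDyer.…` (single-conjunct summit, D-0017 layout)
set_option linter.dupNamespace false
set_option autoImplicit false

open scoped Classical Pointwise
open NumberField WeierstrassCurve IsDedekindDomain Field
open Literature.NumberTheory.EllipticCurves
open Literature.NumberTheory.EllipticCurves.Rank1Residual
open Literature.NumberTheory.GaloisRepresentations
open Summit.BirchSwinnertonDyer.Rank1Residual

namespace Summit.BirchSwinnertonDyer.BirchSwinnertonDyer.Theorems.PrintCFram.HerbrandInertiaAtP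

/-! ## §1 A non-trivial homothety moves every vector of a line and of its quotient -/

section Homothety

variable {p : ℕ} [hp : Fact p.Prime] {K : Type} [Field K] [NumberField K] (E : WeierstrassCurve K)
  (Φ : X2.ResidualDevissageModules.StableSubgroup (absoluteGaloisGroup K) (E.geomTorsion (p : ℤ)))

omit [NumberField K] in
/-- An element acting on `E[p]` as the scalar `c ≢ 1 (mod p)` moves every non-zero vector of a stable line `Φ` of order `p`.
[folklore] -/
theorem smul_ne_sub_of_homothety (hcard : Nat.card Φ.Sub = p) {g : absoluteGaloisGroup K} {c : ℤ} (hc : ¬ (p : ℤ) ∣ c - 1)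
    (hg : ∀ Q : E.geomTorsion (p : ℤ), g • Q = c • Q) {x : Φ.Sub} (hx : x ≠ 0) : g • x ≠ x := by
  intro h
  refine hc (HerbrandLineRestriction.prime_dvd_of_zsmul_eq_zero hcard hx (n := c - 1) ?_)
  have hdx : g • x = c • x := Φ.incl_injective (by rw [Φ.incl_smul, map_zsmul, hg])
  rw [sub_smul, one_smul, ← hdx, h, sub_self]

/-- The same on the quotient `E[p]/Φ` (order `p`). [folklore] -/
theorem smul_ne_quot_of_homothety [E.IsElliptic] (hcard : Nat.card Φ.Sub = p) {g : absoluteGaloisGroup K} {c : ℤ}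
    (hc : ¬ (p : ℤ) ∣ c - 1) (hg : ∀ Q : E.geomTorsion (p : ℤ), g • Q = c • Q) {y : Φ.Quot} (hy : y ≠ 0) : g • y ≠ y := by
  intro h
  have hcardQ : Nat.card Φ.Quot = p := HerbrandLineRestriction.natCard_quot_eq_of_card_sub E Φ hcard
  refine hc (HerbrandLineRestriction.prime_dvd_of_zsmul_eq_zero hcardQ hy (n := c - 1) ?_)
  obtain ⟨m, rfl⟩ := Φ.proj_surjective y
  have hdy : g • Φ.proj m = c • Φ.proj m := by rw [Φ.smul_proj, hg, map_zsmul]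
  rw [sub_smul, one_smul, ← hdy, h, sub_self]

omit [NumberField K] in
/-- If `g` moves some vector of a module on which the group acts through a character `θ` (`θ g = 1 ↔ g` acts trivially, T2's
`exists_character_of_card_prime`), then `θ g ≠ 1`. [folklore] -/
theorem apply_ne_one_of_smul_ne {A : Type} [AddCommGroup A] [DistribMulAction (absoluteGaloisGroup K) A]
    (θ : absoluteGaloisGroup K →* (ZMod p)ˣ) (hker : ∀ g : absoluteGaloisGroup K, θ g = 1 ↔ ∀ a : A, g • a = a)
    {g : absoluteGaloisGroup K} {a : A} (h : g • a ≠ a) : θ g ≠ 1 :=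
  fun h1 ↦ h ((hker g).1 h1 a)

end Homothety

/-! ## §2 The inertia homothety over a field unramified above `p` -/

section Unramified

variable (W : WeierstrassCurve ℚ) [W.IsElliptic] (p : ℕ) [hp : Fact p.Prime]

omit hp in
/-- A place of `K` containing `p` lies above the place `(p)` of `ℚ`. [folklore] -/
theorem natCast_mem_under {K : Type} [Field K] [NumberField K] {w : HeightOneSpectrum (𝓞 K)}
    (hpw : ((p : ℕ) : 𝓞 K) ∈ w.asIdeal) : ((p : ℕ) : 𝓞 ℚ) ∈ (w.under (𝓞 ℚ)).asIdeal := by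
  rw [HeightOneSpectrum.under_asIdeal, Ideal.under_def, Ideal.mem_comap, map_natCast]
  exact hpw

/-- **The inertia homothety at every prime above `p`, over a Galois number field unramified above `p`.** For `W/ℚ` with CM, `p ≥ 5`
CM-ramified, `K/ℚ` Galois and unramified at the place of `ℚ` below `w ∋ p`, and any prime `𝔓` of `\bar ℤ_K` above `w`: some
`g ∈ I_𝔓 ≤ Γ_K` acts on `W_K[p] = W(K̄)[p]` as a scalar `c ≢ 1 (mod p)`. (w4 g2's `(τ²)^p ∈ I_{𝔓 ∩ \bar ℤ_ℚ}` over `ℚ`; it lies in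
`res(Γ_K)` because the place is unramified in `K`; its preimage lies in `I_𝔓`; the actions agree along `E(ℚ̄)[p] ≃ E_K(K̄)[p]`.)
[cite: NeukirchANT1999, Ch. I §9 (9.4)–(9.6)] [cite: GrossLMS1991, §9] [cite: SerreLocalFields1979, Ch. IV §4, Prop. 17–18] -/
theorem exists_mem_inertia_homothety_of_isUnramifiedIn (hCM : W.HasCM) (h5 : 5 ≤ p) (hram : CMRamified W p)
    (K : Type) [Field K] [NumberField K] [IsGalois ℚ K] {w : HeightOneSpectrum (𝓞 K)}
    (hpw : ((p : ℕ) : 𝓞 K) ∈ w.asIdeal) (hunr : Algebra.IsUnramifiedIn (𝓞 K) (w.under (𝓞 ℚ)).asIdeal)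
    {𝔓 : Ideal (absIntegers (𝓞 K) K)} (h𝔓 : 𝔓 ∈ w.primesAbove) :
    ∃ g ∈ 𝔓.inertia (absoluteGaloisGroup K), ∃ c : ℤ, ¬ (p : ℤ) ∣ c - 1 ∧
      ∀ Q : (W.baseChange K).geomTorsion (p : ℤ), g • Q = c • Q := by
  -- the contraction `𝔔 = 𝔓 ∩ \bar ℤ_ℚ` lies above `(p)`
  have h𝔔 : 𝔓.comap (absIntegersMap ℚ K) ∈ (w.under (𝓞 ℚ)).primesAbove :=
    comap_absIntegersMap_mem_primesAbove (K := ℚ) (M := K) (by rw [HeightOneSpectrum.under_asIdeal]) h𝔓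
  -- w4 g2's homothety in `I_𝔔 ≤ Γ_ℚ`
  obtain ⟨g₀, hg₀I, -, c, hc, hg₀⟩ :=
    BorelTorsion.exists_sq_mem_inertia_homothety (W := W) p hCM h5 hram (natCast_mem_under p hpw) h𝔔
  -- it lies in the embedded `Γ_K` (the place is unramified in `K`)
  obtain ⟨g, hg⟩ : g₀ ∈ (absGaloisRestrict ℚ K).range :=
    inertia_le_range_absGaloisRestrict_of_isUnramifiedIn (K := K) hunr h𝔔 hg₀I
  have hg : absGaloisRestrict ℚ K g = g₀ := hg
  refine ⟨g, ?_, c, hc, fun Q ↦ ?_⟩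
  · -- `res⁻¹(I_𝔔) = I_𝔓`
    rw [← comap_inertia_comap_absIntegersMap ℚ K 𝔓, Subgroup.mem_comap]
    change absGaloisRestrict ℚ K g ∈ _
    rw [hg]
    exact hg₀I
  · -- the actions agree along `torsionEquiv`
    obtain ⟨P, rfl⟩ := (RatClosure.torsionEquiv (K := K) W (p : ℤ)).surjective Q
    rw [← RatClosure.torsionEquiv_smul, ← map_zsmul, ← hg₀ P]
    congr 1
    rw [hg]

/-- **The inertia homothety at every prime above `p` over the HEEGNER FIELD of Stub H** (`K` imaginary quadratic satisfying the
Heegner hypothesis for `N_W`; `p ∣ N_W` then splits in `K`, `BorelTorsion.isUnramifiedIn_heegnerField_of_cmRamified`).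
[cite: GrossLMS1991, §1 (p. 235) and §9] [cite: NeukirchANT1999, Ch. I §9 (9.4)–(9.6)] -/
theorem exists_mem_inertia_homothety_heegnerField [W.IsGloballyMinimal] (hCM : W.HasCM) (h5 : 5 ≤ p) (hram : CMRamified W p)
    (K : Type) [Field K] [NumberField K] (hK : IsImaginaryQuadratic K)
    (hH : SatisfiesHeegnerHypothesis (W.conductorNorm ℤ) K) {w : HeightOneSpectrum (𝓞 K)}
    (hpw : ((p : ℕ) : 𝓞 K) ∈ w.asIdeal) {𝔓 : Ideal (absIntegers (𝓞 K) K)} (h𝔓 : 𝔓 ∈ w.primesAbove) :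
    ∃ g ∈ 𝔓.inertia (absoluteGaloisGroup K), ∃ c : ℤ, ¬ (p : ℤ) ∣ c - 1 ∧
      ∀ Q : (W.baseChange K).geomTorsion (p : ℤ), g • Q = c • Q := by
  haveI : Algebra.IsQuadraticExtension ℚ K := ⟨hK.1⟩
  haveI : IsGalois ℚ K := inferInstance
  exact exists_mem_inertia_homothety_of_isUnramifiedIn W p hCM h5 hram K hpw
    (BorelTorsion.isUnramifiedIn_heegnerField_of_cmRamified W p hCM hram K hK hH _ (natCast_mem_under p hpw)) h𝔓

end Unramified

/-! ## §3 On the class, with Stub H's quantifiers: `θ|_{I_𝔓} ≠ 1 ≠ θ'|_{I_𝔓}` at every `𝔓 ∣ p` -/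

section Class

variable (W : WeierstrassCurve ℚ) [W.IsElliptic] [W.IsGloballyMinimal] (p : ℕ) [hp : Fact p.Prime]

/-- **For every stable line `Φ ≤ W_K[p]` of order `p` and every prime `𝔓` of `\bar ℤ_K` above a place `w ∋ p` of the Heegner field
`K`, one element of `I_𝔓` moves a vector of `Φ` AND a vector of `W_K[p]/Φ`** (the homothety `c ≢ 1` on all of `W_K[p]`). M1 §4 (i) and
(iii) inputs: both characters of the line are NON-TRIVIAL on the inertia (a fortiori decomposition) group of every prime above `p`.
[cite: GrossLMS1991, §9] [cite: NeukirchANT1999, Ch. I §9 (9.4)–(9.6)] -/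
theorem exists_mem_inertia_smul_ne_sub_and_quot (hCM : W.HasCM) (h5 : 5 ≤ p) (hram : CMRamified W p)
    (K : Type) [Field K] [NumberField K] (hK : IsImaginaryQuadratic K)
    (hH : SatisfiesHeegnerHypothesis (W.conductorNorm ℤ) K) {w : HeightOneSpectrum (𝓞 K)}
    (hpw : ((p : ℕ) : 𝓞 K) ∈ w.asIdeal) {𝔓 : Ideal (absIntegers (𝓞 K) K)} (h𝔓 : 𝔓 ∈ w.primesAbove)
    (Φ : X2.ResidualDevissageModules.StableSubgroup (absoluteGaloisGroup K) ((W.baseChange K).geomTorsion (p : ℤ)))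
    (hcard : Nat.card Φ.Sub = p) :
    ∃ g ∈ 𝔓.inertia (absoluteGaloisGroup K), (∃ x : Φ.Sub, g • x ≠ x) ∧ ∃ y : Φ.Quot, g • y ≠ y := by
  haveI hE : (W.baseChange K).IsElliptic := by unfold WeierstrassCurve.baseChange; infer_instance
  obtain ⟨g, hgI, c, hc, hg⟩ := exists_mem_inertia_homothety_heegnerField W p hCM h5 hram K hK hH hpw h𝔓
  have hcardQ : Nat.card Φ.Quot = p := HerbrandLineRestriction.natCard_quot_eq_of_card_sub (W.baseChange K) Φ hcard
  haveI : Finite Φ.Sub := Nat.finite_of_card_ne_zero (by rw [hcard]; exact hp.out.ne_zero)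
  haveI : Nontrivial Φ.Sub := Finite.one_lt_card_iff_nontrivial.mp (by rw [hcard]; exact hp.out.one_lt)
  haveI : Finite Φ.Quot := Nat.finite_of_card_ne_zero (by rw [hcardQ]; exact hp.out.ne_zero)
  haveI : Nontrivial Φ.Quot := Finite.one_lt_card_iff_nontrivial.mp (by rw [hcardQ]; exact hp.out.one_lt)
  obtain ⟨x, hx⟩ := exists_ne (0 : Φ.Sub)
  obtain ⟨y, hy⟩ := exists_ne (0 : Φ.Quot)
  exact ⟨g, hgI, ⟨x, smul_ne_sub_of_homothety (W.baseChange K) Φ hcard hc hg hx⟩,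
    ⟨y, smul_ne_quot_of_homothety (W.baseChange K) Φ hcard hc hg hy⟩⟩

/-- **`θ_Φ|_{I_𝔓} ≠ 1` at every prime `𝔓 ∣ p`** for the character `θ` of the line (T2 currency: `θ g = 1 ↔ g` acts trivially on
`Φ`). M1 §4 (i): `(Ind_{Δ_𝔭}^Δ 𝟙)^{(θ)} = 0` since `θ|_{Δ_𝔭} ≠ 1`. [cite: GrossLMS1991, §9] [cite: NeukirchANT1999, Ch. I §9 (9.4)–(9.6)] -/
theorem exists_mem_inertia_charSub_ne_one (hCM : W.HasCM) (h5 : 5 ≤ p) (hram : CMRamified W p)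
    (K : Type) [Field K] [NumberField K] (hK : IsImaginaryQuadratic K)
    (hH : SatisfiesHeegnerHypothesis (W.conductorNorm ℤ) K) {w : HeightOneSpectrum (𝓞 K)}
    (hpw : ((p : ℕ) : 𝓞 K) ∈ w.asIdeal) {𝔓 : Ideal (absIntegers (𝓞 K) K)} (h𝔓 : 𝔓 ∈ w.primesAbove)
    (Φ : X2.ResidualDevissageModules.StableSubgroup (absoluteGaloisGroup K) ((W.baseChange K).geomTorsion (p : ℤ)))
    (hcard : Nat.card Φ.Sub = p) (θ : absoluteGaloisGroup K →* (ZMod p)ˣ)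
    (hker : ∀ g : absoluteGaloisGroup K, θ g = 1 ↔ ∀ x : Φ.Sub, g • x = x) :
    ∃ g ∈ 𝔓.inertia (absoluteGaloisGroup K), θ g ≠ 1 := by
  obtain ⟨g, hgI, ⟨x, hx⟩, -⟩ := exists_mem_inertia_smul_ne_sub_and_quot W p hCM h5 hram K hK hH hpw h𝔓 Φ hcard
  exact ⟨g, hgI, apply_ne_one_of_smul_ne θ hker hx⟩

/-- **`θ'_Φ|_{I_𝔓} ≠ 1` at every prime `𝔓 ∣ p`** for the character `θ'` of the quotient line `W_K[p]/Φ` (`θθ' = χ̄_p ∘ res`, so this is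
«`θ ≠ ω̄` on `I_𝔓`», M1 §4 (iii)). [cite: GrossLMS1991, §9] [cite: NeukirchANT1999, Ch. I §9 (9.4)–(9.6)] -/
theorem exists_mem_inertia_charQuot_ne_one (hCM : W.HasCM) (h5 : 5 ≤ p) (hram : CMRamified W p)
    (K : Type) [Field K] [NumberField K] (hK : IsImaginaryQuadratic K)
    (hH : SatisfiesHeegnerHypothesis (W.conductorNorm ℤ) K) {w : HeightOneSpectrum (𝓞 K)}
    (hpw : ((p : ℕ) : 𝓞 K) ∈ w.asIdeal) {𝔓 : Ideal (absIntegers (𝓞 K) K)} (h𝔓 : 𝔓 ∈ w.primesAbove)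
    (Φ : X2.ResidualDevissageModules.StableSubgroup (absoluteGaloisGroup K) ((W.baseChange K).geomTorsion (p : ℤ)))
    (hcard : Nat.card Φ.Sub = p) (θ' : absoluteGaloisGroup K →* (ZMod p)ˣ)
    (hker' : ∀ g : absoluteGaloisGroup K, θ' g = 1 ↔ ∀ y : Φ.Quot, g • y = y) :
    ∃ g ∈ 𝔓.inertia (absoluteGaloisGroup K), θ' g ≠ 1 := by
  obtain ⟨g, hgI, -, ⟨y, hy⟩⟩ := exists_mem_inertia_smul_ne_sub_and_quot W p hCM h5 hram K hK hH hpw h𝔓 Φ hcard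
  exact ⟨g, hgI, apply_ne_one_of_smul_ne θ' hker' hy⟩

/-- **Both at once, for ONE element**: some `g ∈ I_𝔓` has `θ g ≠ 1` AND `θ' g ≠ 1` (the homothety is the same on both lines).
[cite: GrossLMS1991, §9] [cite: NeukirchANT1999, Ch. I §9 (9.4)–(9.6)] -/
theorem exists_mem_inertia_charSub_ne_one_and_charQuot_ne_one (hCM : W.HasCM) (h5 : 5 ≤ p) (hram : CMRamified W p)
    (K : Type) [Field K] [NumberField K] (hK : IsImaginaryQuadratic K)
    (hH : SatisfiesHeegnerHypothesis (W.conductorNorm ℤ) K) {w : HeightOneSpectrum (𝓞 K)}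
    (hpw : ((p : ℕ) : 𝓞 K) ∈ w.asIdeal) {𝔓 : Ideal (absIntegers (𝓞 K) K)} (h𝔓 : 𝔓 ∈ w.primesAbove)
    (Φ : X2.ResidualDevissageModules.StableSubgroup (absoluteGaloisGroup K) ((W.baseChange K).geomTorsion (p : ℤ)))
    (hcard : Nat.card Φ.Sub = p) (θ θ' : absoluteGaloisGroup K →* (ZMod p)ˣ)
    (hker : ∀ g : absoluteGaloisGroup K, θ g = 1 ↔ ∀ x : Φ.Sub, g • x = x)
    (hker' : ∀ g : absoluteGaloisGroup K, θ' g = 1 ↔ ∀ y : Φ.Quot, g • y = y) :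
    ∃ g ∈ 𝔓.inertia (absoluteGaloisGroup K), θ g ≠ 1 ∧ θ' g ≠ 1 := by
  obtain ⟨g, hgI, ⟨x, hx⟩, ⟨y, hy⟩⟩ := exists_mem_inertia_smul_ne_sub_and_quot W p hCM h5 hram K hK hH hpw h𝔓 Φ hcard
  exact ⟨g, hgI, apply_ne_one_of_smul_ne θ hker hx, apply_ne_one_of_smul_ne θ' hker' hy⟩

end Class

end Summit.BirchSwinnertonDyer.BirchSwinnertonDyer.Theorems.PrintCFram.HerbrandInertiaAtP

end
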